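import Summits.QuantumFields.YangMills.Theorems.IR.BlockedActivityWOfMixing
import HarnessLib

/-!
# Crux `IR` (stmt-QuantumFields-19354), lane B «strong coupling AFTER BLOCKING»: MESH COFINALITY at every `β` — the universal shell condition at
# ONE mesh `b` gives it at EVERY large multiple `K·b` (tolerance `K⁴·θ^j`, NO `β`-loss), and the class of record at every large multiple

Helper module for item `stmt-QuantumFields-19354` (`--supports`; it closes nothing), lane `ym-19354-onsetsc-p2` (g6); corollaries of the refinement ∕
bootstrap ∕ peeling chain of `Theorems/IR/BlockedActivityWOfMixing` and `Theorems/IR/BlockedActivityWRefine`.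

* ★ `univShellCond_coarsen` — a FORMAT theorem (no W-class, no `e^{cβ}`): for continuous `ρ` on a Hausdorff second-countable compact `G`,
  `UnivShellCond ρ β b n ε` (`b ≥ 1`, `ε ≥ 0`) and `j(2n+1) ≤ 2K`, `K ≥ 1` ⇒ **`UnivShellCond ρ β (K·b) 1 (K⁴ · (ε·shellCount n)^j)`**: refine the mesh-`K·b`
  frame into a mesh-`b` frame; the coarse centre cell is `≤ K⁴` fine cells (`card_fineCells_centre_le`), the coarse region is a fine cell union, the coarse
  collar (two coarse cells `≥ 2K·b`) contains the fine cells within index distance `j(2n+1) ≤ 2K` of the centre's fine cells; DLR peeling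
  (`FiniteSizeCriterion.multiCell_influence_general`) over the `≤ K⁴` fine cells on the shape-blind single-cell decay `univShellCond_cell_decay`.
* ★ `univShellCond_cofinal_of_univShellCond` — with `ε·shellCount n < 1`: for every tolerance `ε' > 0` there is `K₀` with `UnivShellCond ρ β (K·b) 1 ε'`
  for ALL `K ≥ K₀` (take `j = ⌊2K∕(2n+1)⌋`: `K⁴ θ^j → 0`).  THE MIXING MESHES OF THE FORMAT ARE COFINAL AMONG THE MULTIPLES OF ANY ONE OF THEM, at every `β`
  (g3∕g5 had cofinality only inside the strong-coupling windows).  Digit: `univShellCond_mul_53` — Uc-grade `(1, 1∕3552)` at mesh `b` ⇒ Uc-grade at mesh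
  `53·b` (`53⁴ · 2⁻³⁵ ≤ 1∕3552`); `univShellCond_uc_cofinal` (Uc-grade at all large multiples).
* ★ `blockedActivityClassW_cofinal_of_univShellCond` — the W-class version: for every radius `a > 0`, `BlockedActivityClassW r.ρ β (K·b) 1 a` for ALL
  `K ≥ K₀(β, b, a)` (not only along the sequence `(j(2n+1)+2)·b` of the sibling file).

HONEST FRAMING: format∕currency bookkeeping valid at every `β`; the universal shell condition at some mesh is ASSUMED, never proved; nothing about the
onset at `b(β) ≍ ξ(β)`, a gap or Clay.  No `sorry`; axioms ⊆ {propext, Classical.choice, Quot.sound}; no instances, no notation.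
-/

set_option autoImplicit false

noncomputable section

open MeasureTheory ProbabilityTheory Filter Topology
open Literature.MathematicalPhysics
open Literature.MathematicalPhysics.QuantumLattice
open Summit.QuantumFields.YangMills.Cruxes.IR.Tempered (cellEdges windowCells regionEdges collarEdges)
open Summit.QuantumFields.YangMills.Cruxes.IR.CellTempered.Engine (frameCell frameCell_eq_iff mem_cellEdges_frameCell frame_hC1 finite_frameCell
  regionEdges_union shiftFrame shiftFrame_mesh)
open Summit.QuantumFields.YangMills.Cruxes.IR.OnsetFormats (shellCount UnivShellCond)
open Summit.QuantumFields.YangMills.Cruxes.IR.AfPincerUc.Calibration (windowCells_subset_windowCellsPlus)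
open Summit.QuantumFields.YangMills.Theorems.FiniteSizeCriterion (multiCell_influence_general)

namespace Summit.QuantumFields.YangMills.Cruxes.IR.BlockedActivity

/-! ## §1 The format coarsens: `UnivShellCond` at mesh `b` ⇒ `UnivShellCond` at mesh `K·b`, window `1`, tolerance `K⁴·θ^j` -/

section Coarsen

variable {G : Type} [Group G] [TopologicalSpace G] [IsTopologicalGroup G] [CompactSpace G] [MeasurableSpace G] [BorelSpace G]
  {N : ℕ} (ρ : G →* Matrix (Fin N) (Fin N) ℂ)

/-- `UnivShellCond` is monotone in the tolerance. -/
theorem univShellCond_of_le {β ε ε' : ℝ} {b n : ℕ} (h : UnivShellCond ρ β b n ε) (hle : ε ≤ ε') : UnivShellCond ρ β b n ε' :=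
  fun w hw Y hY h0 σ σ' ha f hf hfm hf01 => (h w hw Y hY h0 σ σ' ha f hf hfm hf01).trans hle

omit [TopologicalSpace G] [IsTopologicalGroup G] [CompactSpace G] [MeasurableSpace G] [BorelSpace G] in
/-- **The coarse centre cell meets at most `K⁴` fine cells**: the fine cells (of `refineFrame K b w`) of the links of the coarse centre cell `0` have
indices in `[0, K)⁴`. -/
theorem fineCells_centre_subset {K b : ℕ} (hK : 1 ≤ K) (hb : 1 ≤ b) {w : Fin 4 → ℤ → ℤ} (hw : AfPincerUc.IsFrame (K * b) w) :
    (cellEdges w 0).image (frameCell (refineFrame K b w)) ⊆ Fintype.piFinset fun _ : Fin 4 => Finset.Ico (0 : ℤ) (K : ℤ) := by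
  intro y hy
  obtain ⟨e, he, rfl⟩ := Finset.mem_image.1 hy
  have hKb : 1 ≤ K * b := Nat.one_le_iff_ne_zero.2 (Nat.mul_ne_zero (by omega) (by omega))
  have hce : frameCell w e = 0 := (frameCell_eq_iff (frame_step hw hKb) e 0).2 he
  rw [frameCell_eq_ediv_frameCell_refineFrame hK hb hw] at hce
  simp only [Fintype.mem_piFinset, Finset.mem_Ico]
  intro i
  have hi : frameCell (refineFrame K b w) e i / (K : ℤ) = 0 := by
    have := congr_fun hce i
    simpa using this
  obtain ⟨hm, hr0, hrK⟩ := fine_index_decomp hK (frameCell (refineFrame K b w) e i)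
  rw [hi, mul_zero, add_zero] at hm
  constructor <;> linarith

omit [TopologicalSpace G] [IsTopologicalGroup G] [CompactSpace G] [MeasurableSpace G] [BorelSpace G] in
/-- … hence their number is at most `K⁴`. -/
theorem card_fineCells_centre_le {K b : ℕ} (hK : 1 ≤ K) (hb : 1 ≤ b) {w : Fin 4 → ℤ → ℤ} (hw : AfPincerUc.IsFrame (K * b) w) :
    ((cellEdges w 0).image (frameCell (refineFrame K b w))).card ≤ K ^ 4 := by
  refine (Finset.card_le_card (fineCells_centre_subset hK hb hw)).trans ?_
  rw [Fintype.card_piFinset, Finset.prod_const, Finset.card_univ, Fintype.card_fin, Int.card_Ico, sub_zero, Int.toNat_natCast]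

variable [SecondCountableTopology G] [T2Space G]

/-- ★ **THE FORMAT COARSENS (every `β`, no `β`-loss).**  For continuous `ρ`: `UnivShellCond ρ β b n ε` (`b ≥ 1`, `ε ≥ 0`), `K ≥ 1` and `j(2n+1) ≤ 2K` ⇒
`UnivShellCond ρ β (K·b) 1 (K⁴ · (ε·shellCount n)^j)` — the universal shell condition passes from mesh `b` (any window `n`) to every multiple mesh `K·b`
at window `1`, with tolerance the number of fine cells of the coarse centre cell times the `j`-step bootstrap contraction. -/
theorem univShellCond_coarsen (hρ : Continuous ρ) {β ε : ℝ} {b n : ℕ} (hb : 1 ≤ b) (hε : 0 ≤ ε) (hU : UnivShellCond ρ β b n ε)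
    (j : ℕ) {K : ℕ} (hK1 : 1 ≤ K) (hK : j * (2 * n + 1) ≤ 2 * K) :
    UnivShellCond ρ β (K * b) 1 ((K : ℝ) ^ 4 * (ε * shellCount n) ^ j) := by
  classical
  intro w hw Y hY h0 σ σ' hagree f hf hfm hf01
  have hw' : AfPincerUc.IsFrame (K * b) w := hw
  have hu : AfPincerUc.IsFrame b (refineFrame K b w) := isFrame_refineFrame hK1 hw'
  have hKb : 1 ≤ K * b := Nat.one_le_iff_ne_zero.2 (Nat.mul_ne_zero (by omega) (by omega))
  have hw1 := frame_step hw' hKb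
  have hKpos : (0 : ℤ) < (K : ℤ) := by exact_mod_cast hK1
  have hγ := QuantumFieldTheory.isSpecification_ymSpecification_of_t2Space (d := 4) ρ hρ β
  have hθ : 0 ≤ (ε * shellCount n) ^ j := pow_nonneg (mul_nonneg hε (shellCount_nonneg' n)) j
  -- the fine cells of the coarse centre cell
  set Y0 : Finset Cell := (cellEdges w 0).image (frameCell (refineFrame K b w)) with hY0
  have hbox := fineCells_centre_subset hK1 hb hw'
  have hdep : DependsOn f {v | frameCell (refineFrame K b w) v ∈ Y0} := by
    intro U V hUV
    refine hf fun e he => hUV e ?_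
    show frameCell (refineFrame K b w) e ∈ Y0
    rw [hY0]
    exact Finset.mem_image_of_mem (frameCell (refineFrame K b w)) (Finset.mem_coe.1 he)
  -- single-cell decay on the fine frame
  have hR : ∀ (Λ : Finset (ZdEdge 4)), (∀ v v', frameCell (refineFrame K b w) v = frameCell (refineFrame K b w) v' → v ∈ Λ → v' ∈ Λ) →
      ∀ (y : Cell) (g : LGConfig 4 G → ℝ), Measurable g → (∀ σ, 0 ≤ g σ ∧ g σ ≤ 1) →
      DependsOn g {v | frameCell (refineFrame K b w) v = y} →
      ∀ ζ ζ' : LGConfig 4 G, (∀ v, v ∉ Λ → (∀ i, |frameCell (refineFrame K b w) v i - y i| ≤ j * (2 * n + 1)) → ζ v = ζ' v) →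
        |∫ σ, g σ ∂(ymSpecification ρ β Λ ζ) - ∫ σ, g σ ∂(ymSpecification ρ β Λ ζ')| ≤ (ε * shellCount n) ^ j :=
    fun Λ hΛ y g hgm hg01 hgdep ζ ζ' hag => univShellCond_cell_decay ρ hρ hb hε hU hu j Λ hΛ y g hgm hg01 hgdep ζ ζ' hag
  -- the coarse collar covers the fine cells within index distance `j(2n+1) ≤ 2K` of the centre's fine cells
  have hagree' : ∀ y ∈ Y0, ∀ v, v ∉ regionEdges w Y →
      (∀ i, |frameCell (refineFrame K b w) v i - y i| ≤ j * (2 * n + 1)) → σ v = σ' v := by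
    intro y hy v hv hnear
    have hyb := Fintype.mem_piFinset.1 (hbox hy)
    have hvc := mem_cellEdges_frameCell hw1 v
    have hcY : frameCell w v ∉ Y := fun h => hv (Finset.mem_biUnion.2 ⟨_, h, hvc⟩)
    have hcW : frameCell w v ∈ windowCells 1 := by
      rw [frameCell_eq_ediv_frameCell_refineFrame hK1 hb hw']
      simp only [Summit.QuantumFields.YangMills.Cruxes.IR.Tempered.windowCells, Fintype.mem_piFinset, Finset.mem_Icc]
      intro i
      have hyi := Finset.mem_Ico.1 (hyb i)
      have hvi := abs_le.1 (hnear i)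
      have hK2 : (j : ℤ) * (2 * (n : ℤ) + 1) ≤ 2 * (K : ℤ) := by exact_mod_cast hK
      push_cast
      constructor
      · exact Int.le_ediv_of_mul_le hKpos (by linarith)
      · have h3 : frameCell (refineFrame K b w) v i / (K : ℤ) < 3 := Int.ediv_lt_of_lt_mul hKpos (by linarith)
        omega
    exact hagree (frameCell w v) (windowCells_subset_windowCellsPlus _ hcW) hcY hcW v hvc
  have hmain := multiCell_influence_general (V := ZdEdge 4) (S := G) (C := Cell) (cell := frameCell (refineFrame K b w))
    (near := fun y v => ∀ i, |frameCell (refineFrame K b w) v i - y i| ≤ j * (2 * n + 1))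
    (fun v i => by rw [sub_self, abs_zero]; positivity) hγ hR Y0 (regionEdges w Y) (regionEdges_union_refine hK1 hb hw' Y) f hfm hf01 hdep
    σ σ' hagree'
  refine hmain.trans ?_
  have hc : (Y0.card : ℝ) ≤ (K : ℝ) ^ 4 := by exact_mod_cast card_fineCells_centre_le hK1 hb hw'
  exact mul_le_mul_of_nonneg_right hc hθ

/-- ★ **THE MIXING MESHES ARE COFINAL AMONG THE MULTIPLES (every `β`).**  `UnivShellCond ρ β b n ε` with `0 ≤ ε`, `ε·shellCount n < 1`, `b ≥ 1` ⇒ for every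
tolerance `ε' > 0` there is `K₀` with `UnivShellCond ρ β (K·b) 1 ε'` for ALL `K ≥ K₀` (`j = ⌊2K∕(2n+1)⌋`, `K⁴·θ^j → 0`). -/
theorem univShellCond_cofinal_of_univShellCond (hρ : Continuous ρ) {β ε : ℝ} {b n : ℕ} (hb : 1 ≤ b) (hε : 0 ≤ ε)
    (hlt : ε * shellCount n < 1) (hU : UnivShellCond ρ β b n ε) {ε' : ℝ} (hε' : 0 < ε') :
    ∃ K₀ : ℕ, ∀ K : ℕ, K₀ ≤ K → UnivShellCond ρ β (K * b) 1 ε' := by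
  have hθ0 : 0 ≤ ε * shellCount n := mul_nonneg hε (shellCount_nonneg' n)
  -- `g j = ((j(2n+1) + (2n+1))·1)⁴ θ^j → 0`
  have hT := pow_four_mul_geom_tendsto_zero hθ0 hlt (2 * n + 1) (2 * n + 1) 1
  obtain ⟨j₀, hj₀⟩ := eventually_atTop.1 (hT.eventually (gt_mem_nhds hε'))
  refine ⟨j₀ * (2 * n + 1) + 1, fun K hK => ?_⟩
  have hpos : 0 < 2 * n + 1 := by omega
  have hjK : 2 * K / (2 * n + 1) * (2 * n + 1) ≤ 2 * K := Nat.div_mul_le_self (2 * K) (2 * n + 1)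
  have hlt' : 2 * K < 2 * K / (2 * n + 1) * (2 * n + 1) + (2 * n + 1) := Nat.lt_div_mul_add hpos
  have hKj : K ≤ (2 * K / (2 * n + 1) * (2 * n + 1) + (2 * n + 1)) * 1 := by omega
  have hj₀j : j₀ ≤ 2 * K / (2 * n + 1) := (Nat.le_div_iff_mul_le hpos).2 (by omega)
  have hK1 : 1 ≤ K := by omega
  have hUc := univShellCond_coarsen ρ hρ hb hε hU (2 * K / (2 * n + 1)) hK1 hjK
  set j : ℕ := 2 * K / (2 * n + 1) with hj
  refine univShellCond_of_le ρ hUc ?_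
  have hθj : 0 ≤ (ε * shellCount n) ^ j := pow_nonneg hθ0 j
  have hKle : (K : ℝ) ≤ ((((j * (2 * n + 1) + (2 * n + 1)) * 1 : ℕ)) : ℝ) := by exact_mod_cast hKj
  have hK0 : (0 : ℝ) ≤ (K : ℝ) := Nat.cast_nonneg K
  calc (K : ℝ) ^ 4 * (ε * shellCount n) ^ j ≤ ((((j * (2 * n + 1) + (2 * n + 1)) * 1 : ℕ)) : ℝ) ^ 4 * (ε * shellCount n) ^ j := by gcongr
    _ ≤ ε' := (hj₀ j hj₀j).le

/-- **Uc-grade cofinality**: `UnivShellCond ρ β b n ε` (admissible) ⇒ `UnivShellCond ρ β (K·b) 1 (1∕3552)` for all large `K` — the registered Uc format's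
mixing grade `(n, ε) = (1, 1∕3552)` at every large multiple of ANY mixing mesh. -/
theorem univShellCond_uc_cofinal (hρ : Continuous ρ) {β ε : ℝ} {b n : ℕ} (hb : 1 ≤ b) (hε : 0 ≤ ε)
    (hlt : ε * shellCount n < 1) (hU : UnivShellCond ρ β b n ε) :
    ∃ K₀ : ℕ, ∀ K : ℕ, K₀ ≤ K → UnivShellCond ρ β (K * b) 1 (1 / 3552) :=
  univShellCond_cofinal_of_univShellCond ρ hρ hb hε hlt hU (by norm_num)

/-- **Digit**: Uc-grade `(1, 1∕3552)` at mesh `b` ⇒ Uc-grade at mesh `53·b` (`j = 35`, `35·3 ≤ 106`, `53⁴·(1776∕3552)³⁵ = 53⁴·2⁻³⁵ ≤ 1∕3552`). -/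
theorem univShellCond_mul_53 (hρ : Continuous ρ) {β : ℝ} {b : ℕ} (hb : 1 ≤ b) (hU : UnivShellCond ρ β b 1 (1 / 3552)) :
    UnivShellCond ρ β (53 * b) 1 (1 / 3552) := by
  have h := univShellCond_coarsen ρ hρ hb (by norm_num) hU 35 (K := 53) (by norm_num) (by norm_num)
  refine univShellCond_of_le ρ h ?_
  rw [shellCount_one]
  norm_num

end Coarsen

/-! ## §2 The class of record at EVERY large multiple of the mixing mesh -/

section ClassWCofinal

variable (G : Type) [Group G] [TopologicalSpace G] [IsTopologicalGroup G] [CompactSpace G] [MeasurableSpace G] [BorelSpace G]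
  (r : Literature.MathematicalPhysics.QuantumFieldTheory.LatticeRep G)

/-- ★ **The W-class at every radius at ALL large multiples of the mixing mesh.**  `UnivShellCond r.ρ β b n ε` (`0 ≤ ε`, `ε·shellCount n < 1`, `b ≥ 1`),
`a > 0` ⇒ `∃ K₀, ∀ K ≥ K₀, BlockedActivityClassW r.ρ β (K·b) 1 a` (`j = ⌊(K−2)∕(2n+1)⌋` bootstrap steps; the radius at mesh `K·b` is at most the radius
at mesh `(j(2n+1) + 2n + 3)·b`, which tends to `0`). -/
theorem blockedActivityClassW_cofinal_of_univShellCond {β ε : ℝ} {b n : ℕ} (hb : 1 ≤ b) (hε : 0 ≤ ε) (hlt : ε * shellCount n < 1)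
    (hU : UnivShellCond r.ρ β b n ε) {a : ℝ} (ha : 0 < a) :
    ∃ K₀ : ℕ, ∀ K : ℕ, K₀ ≤ K → BlockedActivityClassW r.ρ β (K * b) 1 a := by
  have hθ0 : 0 ≤ ε * shellCount n := mul_nonneg hε (shellCount_nonneg' n)
  have hT := mixingRadius_linear_tendsto_zero r.N β hθ0 hlt (2 * n + 1) (2 * n + 3) b
  obtain ⟨j₀, hj₀⟩ := eventually_atTop.1 (hT.eventually (gt_mem_nhds ha))
  refine ⟨j₀ * (2 * n + 1) + 2, fun K hK => ?_⟩
  have hpos : 0 < 2 * n + 1 := by omega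
  have hle' : (K - 2) / (2 * n + 1) * (2 * n + 1) ≤ K - 2 := Nat.div_mul_le_self (K - 2) (2 * n + 1)
  have hlt' : K - 2 < (K - 2) / (2 * n + 1) * (2 * n + 1) + (2 * n + 1) := Nat.lt_div_mul_add hpos
  have hjK : (K - 2) / (2 * n + 1) * (2 * n + 1) + 2 ≤ K := by omega
  have hKj : K ≤ (K - 2) / (2 * n + 1) * (2 * n + 1) + (2 * n + 3) := by omega
  have hj₀j : j₀ ≤ (K - 2) / (2 * n + 1) := (Nat.le_div_iff_mul_le hpos).2 (by omega)
  refine blockedActivityClassW_mono G (blockedActivityClassW_of_univShellCond G r hb hε hU ((K - 2) / (2 * n + 1)) hjK) ?_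
  exact (mixingRadius_mono_mesh r.N β hθ0 (Nat.mul_le_mul_right b hKj) _).trans (hj₀ _ hj₀j).le

end ClassWCofinal

end Summit.QuantumFields.YangMills.Cruxes.IR.BlockedActivity

end
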